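import Summits.CriticalPhenomena.CardyFormulaZ2.Theorems.CardyComplexConeEdgePrecompactUFRSStrandsArms

/-!
# Three strands of one completion ⇒ half-plane arms, II: lattice-box geometry at mesh `1`
(line `qkz-strip-boundary-arm` of crux `CardyComplexCone.EdgePrecompact`, stmt-CriticalPhenomena-11387;
geometric input of the registered sub-goal `ufrs_rect_strandsHpArms_pure`, HT-A pure case)

The exterior-set sector lemma `strands_sectorsZ` (`…UFRSStrandsHpArmsPureSectors.lean`) is applied,
for strands through the inner faces of the lattice box `[a₀, a₁] × [b₀, b₁]` of a rectangle, with
the EXTERIOR SET `exteriorSet z r R a₀ a₁ b₀ b₁`: the part of the open annulus `(r + 1/2, R - 1/2)`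
about `z` outside the box shrunk by `1/8` (`shrunkBox`). This file supplies the lattice geometry:

* `sPt_mem_shrunkBox`, `tPt_mem_shrunkBox`: the perturbed points of a corner lie in the closed
  square of its face shrunk by `1/8`, hence in `shrunkBox` when the face is an inner face of the
  box; so every dart piece and connector of a strand through inner faces misses the exterior set
  (`piece_not_mem_exteriorSet`, `conn_not_mem_exteriorSet`; registered anchor
  `ufrs_piecesMissExterior`);
* `moat_bottom_HTP`, …, `moat_top_HTP`: for a face `f`, the corner whose (closed) target edge is the
  bottom / left / right / top side of `f` and whose crossing segment leaves `f` through that side —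
  the probe that joins a moat face of a FREE window to the exterior set;
* small coordinate facts (`vertex_bounds_of_face_HTP`, `probe_mem_segment_HTP`, …).

References: S. Smirnov, C. R. Acad. Sci. Paris 333 (2001), §2 (medial lattice, perturbed
interfaces); M. Aizenman, A. Burchard, Duke Math. J. 99 (1999), Appendix A.
-/

namespace Summit.CriticalPhenomena.CardyFormulaZ2.Cruxes.EdgePrecompact.QkzStripBoundaryArm

open MeasureTheory Filter Set Metric Complex
open scoped Topology BigOperators Pointwise
open Literature.Probability.LatticeModels Literature.Probability.Percolation
open Literature.Probability.RandomPlanarGeometry (DobrushinDomain)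
open Summit.CriticalPhenomena.CardyFormulaZ2.Theses.CardyComplexCone

noncomputable section

/-! ## The shrunk box and the exterior set -/

/-- The lattice box `[a₀, a₁] × [b₀, b₁]` shrunk by `1/8` (a closed rectangle of the plane): it
contains every perturbed piece of a strand through inner faces of the box. -/
def shrunkBox (a₀ a₁ b₀ b₁ : ℤ) : Set ℂ :=
  {w | (a₀ : ℝ) + 1 / 8 ≤ w.re ∧ w.re ≤ (a₁ : ℝ) - 1 / 8 ∧ (b₀ : ℝ) + 1 / 8 ≤ w.im ∧ w.im ≤ (b₁ : ℝ) - 1 / 8}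

/-- **The exterior set** of the box in the open annulus `(r + 1/2, R - 1/2)` about `z`: the points
of the annulus outside the shrunk box (beyond one of its four sides). -/
def exteriorSet (z : ℂ) (r R : ℝ) (a₀ a₁ b₀ b₁ : ℤ) : Set ℂ :=
  {w | (r + 1 / 2 < dist w z ∧ dist w z < R - 1 / 2) ∧
    (w.re < (a₀ : ℝ) + 1 / 8 ∨ (a₁ : ℝ) - 1 / 8 < w.re ∨ w.im < (b₀ : ℝ) + 1 / 8 ∨ (b₁ : ℝ) - 1 / 8 < w.im)}

/-- Membership in the exterior set, unfolded. -/
theorem mem_exteriorSet_iff {z : ℂ} {r R : ℝ} {a₀ a₁ b₀ b₁ : ℤ} {w : ℂ} :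
    w ∈ exteriorSet z r R a₀ a₁ b₀ b₁ ↔ (r + 1 / 2 < dist w z ∧ dist w z < R - 1 / 2) ∧
      (w.re < (a₀ : ℝ) + 1 / 8 ∨ (a₁ : ℝ) - 1 / 8 < w.re ∨ w.im < (b₀ : ℝ) + 1 / 8 ∨ (b₁ : ℝ) - 1 / 8 < w.im) :=
  Iff.rfl

/-- The shrunk box is convex. -/
theorem convex_shrunkBox (a₀ a₁ b₀ b₁ : ℤ) : Convex ℝ (shrunkBox a₀ a₁ b₀ b₁) := by
  have h1 : Convex ℝ {w : ℂ | (a₀ : ℝ) + 1 / 8 ≤ w.re} := convex_halfSpace_re_ge _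
  have h2 : Convex ℝ {w : ℂ | w.re ≤ (a₁ : ℝ) - 1 / 8} := convex_halfSpace_re_le _
  have h3 : Convex ℝ {w : ℂ | (b₀ : ℝ) + 1 / 8 ≤ w.im} := convex_halfSpace_im_ge _
  have h4 : Convex ℝ {w : ℂ | w.im ≤ (b₁ : ℝ) - 1 / 8} := convex_halfSpace_im_le _
  have : shrunkBox a₀ a₁ b₀ b₁ = {w : ℂ | (a₀ : ℝ) + 1 / 8 ≤ w.re} ∩ {w : ℂ | w.re ≤ (a₁ : ℝ) - 1 / 8} ∩
      {w : ℂ | (b₀ : ℝ) + 1 / 8 ≤ w.im} ∩ {w : ℂ | w.im ≤ (b₁ : ℝ) - 1 / 8} := by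
    ext w; simp only [shrunkBox, mem_setOf_eq, mem_inter_iff]; tauto
  rw [this]
  exact ((h1.inter h2).inter h3).inter h4

/-- The exterior set misses the shrunk box. -/
theorem not_mem_exteriorSet_of_mem_shrunkBox {z : ℂ} {r R : ℝ} {a₀ a₁ b₀ b₁ : ℤ} {w : ℂ}
    (hw : w ∈ shrunkBox a₀ a₁ b₀ b₁) : w ∉ exteriorSet z r R a₀ a₁ b₀ b₁ := by
  rintro ⟨-, h | h | h | h⟩ <;> obtain ⟨h1, h2, h3, h4⟩ := hw <;> linarith

/-- The exterior set lies in the open annulus. -/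
theorem exteriorSet_annulus {z : ℂ} {r R : ℝ} {a₀ a₁ b₀ b₁ : ℤ} :
    ∀ w ∈ exteriorSet z r R a₀ a₁ b₀ b₁, r + 1 / 2 < dist w z ∧ dist w z < R - 1 / 2 :=
  fun _ hw => hw.1

/-- A segment with endpoints in the shrunk box misses the exterior set. -/
theorem segment_not_mem_exteriorSet {z : ℂ} {r R : ℝ} {a₀ a₁ b₀ b₁ : ℤ} {A B : ℂ}
    (hA : A ∈ shrunkBox a₀ a₁ b₀ b₁) (hB : B ∈ shrunkBox a₀ a₁ b₀ b₁) :
    ∀ w ∈ segment ℝ A B, w ∉ exteriorSet z r R a₀ a₁ b₀ b₁ :=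
  fun _ hw => not_mem_exteriorSet_of_mem_shrunkBox ((convex_shrunkBox a₀ a₁ b₀ b₁).segment_subset hA hB hw)

/-! ## The perturbed points of a corner lie in its face shrunk by `1/8` -/

/-- Coordinates of the perturbed source point relative to the face of the corner. -/
theorem sPt_re_im_bounds (p : Site 2 × Fin 4) :
    ((cFace p) 0 : ℝ) + 1 / 8 ≤ (sPt p).re ∧ (sPt p).re ≤ ((cFace p) 0 : ℝ) + 7 / 8 ∧
      ((cFace p) 1 : ℝ) + 1 / 8 ≤ (sPt p).im ∧ (sPt p).im ≤ ((cFace p) 1 : ℝ) + 7 / 8 := by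
  obtain ⟨v, k⟩ := p
  fin_cases k <;>
    simp [sPt, cFace, faceAt, cornerOff, dS, Site.toComplex, pow_succ] <;>
    (repeat' (first | (apply And.intro) | linarith))

/-- Coordinates of the perturbed target point relative to the face of the corner. -/
theorem tPt_re_im_bounds (p : Site 2 × Fin 4) :
    ((cFace p) 0 : ℝ) + 1 / 8 ≤ (tPt p).re ∧ (tPt p).re ≤ ((cFace p) 0 : ℝ) + 7 / 8 ∧
      ((cFace p) 1 : ℝ) + 1 / 8 ≤ (tPt p).im ∧ (tPt p).im ≤ ((cFace p) 1 : ℝ) + 7 / 8 := by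
  obtain ⟨v, k⟩ := p
  fin_cases k <;>
    simp [tPt, cFace, faceAt, cornerOff, dT, Site.toComplex, pow_succ] <;>
    (repeat' (first | (apply And.intro) | linarith))

/-- If the face of a corner lies in the box with its upper and right neighbours (an inner face of
the box), its perturbed source point lies in the shrunk box. -/
theorem sPt_mem_shrunkBox {a₀ a₁ b₀ b₁ : ℤ} {p : Site 2 × Fin 4}
    (hf : a₀ ≤ (cFace p) 0 ∧ (cFace p) 0 + 1 ≤ a₁ ∧ b₀ ≤ (cFace p) 1 ∧ (cFace p) 1 + 1 ≤ b₁) :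
    sPt p ∈ shrunkBox a₀ a₁ b₀ b₁ := by
  obtain ⟨h1, h2, h3, h4⟩ := sPt_re_im_bounds p
  obtain ⟨g1, g2, g3, g4⟩ := hf
  have e1 : (a₀ : ℝ) ≤ (cFace p) 0 := by exact_mod_cast g1
  have e2 : ((cFace p) 0 : ℝ) + 1 ≤ a₁ := by exact_mod_cast g2
  have e3 : (b₀ : ℝ) ≤ (cFace p) 1 := by exact_mod_cast g3
  have e4 : ((cFace p) 1 : ℝ) + 1 ≤ b₁ := by exact_mod_cast g4
  exact ⟨by linarith, by linarith, by linarith, by linarith⟩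

/-- Same for the perturbed target point. -/
theorem tPt_mem_shrunkBox {a₀ a₁ b₀ b₁ : ℤ} {p : Site 2 × Fin 4}
    (hf : a₀ ≤ (cFace p) 0 ∧ (cFace p) 0 + 1 ≤ a₁ ∧ b₀ ≤ (cFace p) 1 ∧ (cFace p) 1 + 1 ≤ b₁) :
    tPt p ∈ shrunkBox a₀ a₁ b₀ b₁ := by
  obtain ⟨h1, h2, h3, h4⟩ := tPt_re_im_bounds p
  obtain ⟨g1, g2, g3, g4⟩ := hf
  have e1 : (a₀ : ℝ) ≤ (cFace p) 0 := by exact_mod_cast g1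
  have e2 : ((cFace p) 0 : ℝ) + 1 ≤ a₁ := by exact_mod_cast g2
  have e3 : (b₀ : ℝ) ≤ (cFace p) 1 := by exact_mod_cast g3
  have e4 : ((cFace p) 1 : ℝ) + 1 ≤ b₁ := by exact_mod_cast g4
  exact ⟨by linarith, by linarith, by linarith, by linarith⟩

/-- **Pieces of strands through inner faces miss the exterior set** (registered anchor
`ufrs_piecesMissExterior` of stmt-CriticalPhenomena-11387): along a stretch `O c [i, j]` of an
orbit of `nextCorner β` whose faces lie in the box `[a₀, a₁] × [b₀, b₁]` together with their upper
and right neighbours, every dart piece and every connector misses `exteriorSet z r R a₀ a₁ b₀ b₁`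
(the format of the hypothesis `hZK` of `strands_sectorsZ`). -/
theorem ufrs_piecesMissExterior : ∀ (β : BondConfig (Site 2)) (c : Site 2 × Fin 4) (i j : ℕ) (z : ℂ) (r R : ℝ) (a₀ a₁ b₀ b₁ : ℤ), (∀ t, i ≤ t → t ≤ j → a₀ ≤ (cFace (cornerOrbit β c t)) 0 ∧ (cFace (cornerOrbit β c t)) 0 + 1 ≤ a₁ ∧ b₀ ≤ (cFace (cornerOrbit β c t)) 1 ∧ (cFace (cornerOrbit β c t)) 1 + 1 ≤ b₁) → ∀ t, i ≤ t → t ≤ j → (∀ w ∈ segment ℝ (sPt (cornerOrbit β c t)) (tPt (cornerOrbit β c t)), w ∉ exteriorSet z r R a₀ a₁ b₀ b₁) ∧ (t < j → ∀ w ∈ segment ℝ (tPt (cornerOrbit β c t)) (sPt (cornerOrbit β c (t + 1))), w ∉ exteriorSet z r R a₀ a₁ b₀ b₁) := by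
  intro β c i j z r R a₀ a₁ b₀ b₁ hIn t hit htj
  refine ⟨segment_not_mem_exteriorSet (sPt_mem_shrunkBox (hIn t hit htj)) (tPt_mem_shrunkBox (hIn t hit htj)),
    fun htj' => segment_not_mem_exteriorSet (tPt_mem_shrunkBox (hIn t hit htj)) (sPt_mem_shrunkBox (hIn (t + 1) (by omega) htj'))⟩

/-! ## Vertices and faces in coordinates -/

/-- The vertex of a corner is a corner of its face: coordinates. -/
theorem vertex_bounds_of_face_HTP (p : Site 2 × Fin 4) :
    (cFace p) 0 ≤ p.1 0 ∧ p.1 0 ≤ (cFace p) 0 + 1 ∧ (cFace p) 1 ≤ p.1 1 ∧ p.1 1 ≤ (cFace p) 1 + 1 := by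
  obtain ⟨v, k⟩ := p
  fin_cases k <;> simp [cFace, faceAt, cornerOff]

/-- The other endpoint of the target edge of a corner is a corner of its face: coordinates. -/
theorem tgt_bounds_of_face_HTP (p : Site 2 × Fin 4) :
    (cFace p) 0 ≤ (p.1 + cornerUnit (p.2 + 1)) 0 ∧ (p.1 + cornerUnit (p.2 + 1)) 0 ≤ (cFace p) 0 + 1 ∧
      (cFace p) 1 ≤ (p.1 + cornerUnit (p.2 + 1)) 1 ∧ (p.1 + cornerUnit (p.2 + 1)) 1 ≤ (cFace p) 1 + 1 := by
  obtain ⟨v, k⟩ := p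
  fin_cases k <;> simp [cFace, faceAt, cornerOff, cornerUnit]

/-- The target edge of a corner, as an explicit pair. -/
theorem cTgt_eq_mk (p : Site 2 × Fin 4) : cTgt p = s(p.1, p.1 + cornerUnit (p.2 + 1)) := rfl

/-- The two endpoints of the target edge of a corner are within `1` of its vertex. -/
theorem dist_le_one_of_mem_cTgt {p : Site 2 × Fin 4} {x : Site 2} (hx : x ∈ cTgt p) :
    dist (Site.toComplex x) (Site.toComplex p.1) ≤ 1 := by
  rw [cTgt_eq_mk, Sym2.mem_iff] at hx
  rcases hx with rfl | rfl
  · simp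
  · obtain ⟨v, k⟩ := p
    rw [dist_eq_norm]
    have key : ∀ k' : Fin 4, ‖Site.toComplex (v + cornerUnit k') - Site.toComplex v‖ ≤ 1 := by
      intro k'
      have h : Site.toComplex (v + cornerUnit k') - Site.toComplex v = I ^ (k' : ℕ) := by
        fin_cases k' <;> apply Complex.ext <;> simp [Site.toComplex, cornerUnit, pow_succ]
      rw [h, norm_pow, norm_I, one_pow]
    exact key (k + 1)

/-- A lattice point is within `3/4` of the centre of any face of which it is a corner (coordinates). -/
theorem dist_faceCenter_lt_of_bounds {f x : Site 2} (h : f 0 ≤ x 0 ∧ x 0 ≤ f 0 + 1 ∧ f 1 ≤ x 1 ∧ x 1 ≤ f 1 + 1) :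
    dist (Site.toComplex x) (faceCenter f) < 3 / 4 := by
  obtain ⟨h1, h2, h3, h4⟩ := h
  have hx0 : x 0 = f 0 ∨ x 0 = f 0 + 1 := by omega
  have hx1 : x 1 = f 1 ∨ x 1 = f 1 + 1 := by omega
  have hre : (Site.toComplex x - faceCenter f).re = (x 0 : ℝ) - f 0 - 1 / 2 := by
    simp [faceCenter, Site.toComplex]; ring
  have him : (Site.toComplex x - faceCenter f).im = (x 1 : ℝ) - f 1 - 1 / 2 := by
    simp [faceCenter, Site.toComplex]; ring
  have hre' : (Site.toComplex x - faceCenter f).re ^ 2 = 1 / 4 := by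
    rw [hre]; rcases hx0 with e | e <;> rw [e] <;> push_cast <;> ring
  have him' : (Site.toComplex x - faceCenter f).im ^ 2 = 1 / 4 := by
    rw [him]; rcases hx1 with e | e <;> rw [e] <;> push_cast <;> ring
  rw [dist_eq_norm]
  have h2 : ‖Site.toComplex x - faceCenter f‖ ^ 2 < (3 / 4) ^ 2 := by
    rw [Complex.sq_norm, Complex.normSq_apply]; nlinarith
  exact lt_of_pow_lt_pow_left₀ 2 (by norm_num) h2

/-! ## Moat corners: leaving a face through one of its sides -/

/-- The centre of a translated face. -/
theorem faceCenter_add (f v : Site 2) : faceCenter (f + v) = faceCenter f + Site.toComplex v := by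
  apply Complex.ext
  · simp [faceCenter, Site.toComplex]; ring
  · simp [faceCenter, Site.toComplex]; ring

/-- **Bottom moat corner.** The corner `(f + e₀, 1)` has face `f`, target edge the bottom side
`{f + e₀, f}` of `f`, and its crossing segment runs from the centre of `f` straight down. -/
theorem moat_bottom_HTP (f : Site 2) :
    cFace (f + Pi.single 0 1, 1) = f ∧ cTgt (f + Pi.single 0 1, 1) = s(f + Pi.single 0 1, f) ∧
      faceCenter (faceAt (f + Pi.single 0 1) (1 + 1)) = faceCenter f - I := by
  refine ⟨?_, ?_, ?_⟩
  · simp [cFace, faceAt, cornerOff]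
  · rw [cTgt_eq_mk]
    congr 1
    ext i; fin_cases i <;> simp [cornerUnit]
  · apply Complex.ext
    · simp [faceCenter, faceAt, cornerOff, Site.toComplex]
    · simp [faceCenter, faceAt, cornerOff, Site.toComplex]; ring

/-- **Left moat corner.** The corner `(f, 0)` has face `f`, target edge the left side `{f, f + e₁}`,
and its crossing segment runs from the centre of `f` straight to the left. -/
theorem moat_left_HTP (f : Site 2) :
    cFace (f, 0) = f ∧ cTgt (f, 0) = s(f, f + Pi.single 1 1) ∧ faceCenter (faceAt f (0 + 1)) = faceCenter f - 1 := by
  refine ⟨?_, ?_, ?_⟩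
  · simp [cFace, faceAt, cornerOff]
  · rw [cTgt_eq_mk]
    congr 1
  · apply Complex.ext
    · simp [faceCenter, faceAt, cornerOff, Site.toComplex]; ring
    · simp [faceCenter, faceAt, cornerOff, Site.toComplex]

/-- **Right moat corner.** The corner `(f + e₀ + e₁, 2)` has face `f`, target edge the right side
`{f + e₀ + e₁, f + e₀}`, and its crossing segment runs from the centre of `f` straight to the right. -/
theorem moat_right_HTP (f : Site 2) :
    cFace (f + Pi.single 0 1 + Pi.single 1 1, 2) = f ∧
      cTgt (f + Pi.single 0 1 + Pi.single 1 1, 2) = s(f + Pi.single 0 1 + Pi.single 1 1, f + Pi.single 0 1) ∧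
      faceCenter (faceAt (f + Pi.single 0 1 + Pi.single 1 1) (2 + 1)) = faceCenter f + 1 := by
  refine ⟨?_, ?_, ?_⟩
  · simp [cFace, faceAt, cornerOff]
  · rw [cTgt_eq_mk]
    congr 1
    ext i; fin_cases i <;> simp [cornerUnit]
  · apply Complex.ext
    · simp [faceCenter, faceAt, cornerOff, Site.toComplex]; ring
    · simp [faceCenter, faceAt, cornerOff, Site.toComplex]

/-- **Top moat corner.** The corner `(f + e₁, 3)` has face `f`, target edge the top side
`{f + e₁, f + e₁ + e₀}`, and its crossing segment runs from the centre of `f` straight up. -/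
theorem moat_top_HTP (f : Site 2) :
    cFace (f + Pi.single 1 1, 3) = f ∧ cTgt (f + Pi.single 1 1, 3) = s(f + Pi.single 1 1, f + Pi.single 1 1 + Pi.single 0 1) ∧
      faceCenter (faceAt (f + Pi.single 1 1) (3 + 1)) = faceCenter f + I := by
  refine ⟨?_, ?_, ?_⟩
  · simp [cFace, faceAt, cornerOff]
  · rw [cTgt_eq_mk]
    congr 1
  · apply Complex.ext
    · simp [faceCenter, faceAt, cornerOff, Site.toComplex]
    · simp [faceCenter, faceAt, cornerOff, Site.toComplex]; ring

/-- **The probe point.** For a unit step `d` (`‖d‖ ≤ 1`), the point `P = c + (7/16) d` lies on the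
segment `[c, c + d]`, and every point of `[c, P]` is within `7/16` of `c`. -/
theorem probe_mem_segment_HTP (c d : ℂ) (hd : ‖d‖ ≤ 1) :
    c + ((7 : ℝ) / 16) • d ∈ segment ℝ c (c + d) ∧ ∀ w ∈ segment ℝ c (c + ((7 : ℝ) / 16) • d), dist w c ≤ 7 / 16 := by
  constructor
  · rw [segment_eq_image']
    exact ⟨7 / 16, ⟨by norm_num, by norm_num⟩, by simp⟩
  · intro w hw
    rw [segment_eq_image'] at hw
    obtain ⟨t, ⟨ht0, ht1⟩, rfl⟩ := hw
    rw [dist_eq_norm, add_sub_cancel_left, add_sub_cancel_left, norm_smul, norm_smul, Real.norm_eq_abs,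
      Real.norm_eq_abs, abs_of_nonneg ht0, abs_of_nonneg (by norm_num : (0 : ℝ) ≤ 7 / 16)]
    nlinarith [norm_nonneg d]

/-- A probe of length `≤ 7/16` from a point at distance in `(r + 1, R - 1)` from `z` stays in the
open annulus `(r + 1/2, R - 1/2)`. -/
theorem probe_annulus_HTP {c z : ℂ} {r R : ℝ} (hc : r + 1 < dist c z ∧ dist c z < R - 1) {w : ℂ}
    (hw : dist w c ≤ 7 / 16) : r + 1 / 2 < dist w z ∧ dist w z < R - 1 / 2 := by
  constructor
  · linarith [dist_triangle c w z, dist_comm c w]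
  · linarith [dist_triangle w c z]

end

end Summit.CriticalPhenomena.CardyFormulaZ2.Cruxes.EdgePrecompact.QkzStripBoundaryArm
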